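import Literature.Analysis.UnboundedOperators.LinearMildUniqueness
import HarnessLib

/-!
# The linear mild equation: the identity from the origin out of the identities on interior windows

Analysis/UnboundedOperators support file (everything proved; no definitions, no named facts), companion of
`LinearMildUniqueness.lean`.  Setting: a real Banach space `E`, contractions `T(t)` (`t ≥ 0`) strongly
continuous with `T(0) = 1`, bounded operators `K(t)` strongly continuous on `(0, ∞)` with the weakly
singular bound `‖K(t)‖ ≤ C t^{−α}` (`α < 1`), and coefficient operators `B(s)`.

`linearMild_of_forall_window` — **from windows to the origin.**  Let `Z` be continuous on `[0, τ]` with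
continuous source `s ↦ B(s) Z(s)` there, and suppose that on EVERY interior window `[ε, τ]`, `0 < ε < τ`,
`Z` solves the linear mild equation from its own value `Z(ε)`:

  `Z(ε + t) = T(t) Z(ε) − ∫₀ᵗ K(t − s) B(ε + s) Z(ε + s) ds`     (`0 ≤ t ≤ τ − ε`).

Then `Z` solves it from the origin: `Z(t) = T(t) Z(0) − ∫₀ᵗ K(t − s) B(s) Z(s) ds` on `[0, τ]`.  Proof: for
fixed `t ∈ (0, τ]` and `0 < ε < t` the window identity reads, after the substitution `s ↦ s − ε`,
`Z(t) = T(t − ε) Z(ε) − ∫_ε^t K(t − s) B(s) Z(s) ds`; as `ε → 0⁺` the right-hand side tends to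
`T(t) Z(0) − ∫₀ᵗ K(t − s) B(s) Z(s) ds` (strong continuity and contractivity of `T`, continuity of `Z` at
`0`, integrability of the weakly singular integrand on `[0, t]` and continuity of its primitive in the lower
limit), while the left-hand side is constant.

This is how the derivative of a parabolic semiflow at a ROUGH datum is identified: the candidate built from
the linearised PDE solves the mild identity on every window away from the initial time (where it is
classical), is continuous up to the initial time in the phase space, and therefore solves the identity
from the initial time, where uniqueness (`linearMild_unique`) applies (D. Henry, *Geometric Theory of
Semilinear Parabolic Equations*, LNM 840 (1981), Lemma 3.3.2, Thm. 3.3.3, Cor. 3.4.6).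

## References

* D. Henry, *Geometric Theory of Semilinear Parabolic Equations*, LNM 840, Springer (1981), Lemma 3.3.2,
  Thm. 3.3.3, Cor. 3.4.6. [Henry1981]
* A. Pazy, *Semigroups of Linear Operators and Applications to Partial Differential Equations*, Springer
  (1983), §6.3, Thm. 6.3.1. [Pazy1983]
-/

noncomputable section

open Set Filter MeasureTheory intervalIntegral
open _root_.Topology

namespace Literature.Analysis.UnboundedOperators

variable {E : Type*} [NormedAddCommGroup E] [NormedSpace ℝ E]

/-- **The linear mild identity from the origin out of the identities on all interior windows** (Henry
1981, Lemma 3.3.2 / Thm. 3.3.3).  Let `T(t)` be strongly continuous contractions with `T(0) = 1`, `K(t)`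
strongly continuous on `(0, ∞)` with `‖K(t)‖ ≤ C t^{−α}` (`α < 1`), `B(s)` coefficient operators, and `Z`
continuous on `[0, τ]` with continuous source `s ↦ B(s) Z(s)` there.  If for every `0 < ε < τ` and every
`t ∈ [0, τ − ε]`, `Z(ε + t) = T(t) Z(ε) − ∫₀ᵗ K(t − s) B(ε + s) Z(ε + s) ds`, then for every `t ∈ [0, τ]`,
`Z(t) = T(t) Z(0) − ∫₀ᵗ K(t − s) B(s) Z(s) ds`. [cite: Henry1981, Lemma 3.3.2 and Thm 3.3.3] -/
theorem linearMild_of_forall_window (T K : ℝ → E →L[ℝ] E) (hT0 : T 0 = 1)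
    (hTnorm : ∀ t, 0 ≤ t → ‖T t‖ ≤ 1) (hTc : ∀ y : E, Continuous fun t : ℝ => T t y)
    {α C : ℝ} (hα : α < 1) (hK : ∀ t, 0 < t → ‖K t‖ ≤ C * t ^ (-α))
    (hKc : ∀ y : E, ContinuousOn (fun t : ℝ => K t y) (Ioi 0)) {τ : ℝ} (B : ℝ → E →L[ℝ] E) {Z : ℝ → E}
    (hZ : ContinuousOn Z (Icc 0 τ)) (hg : ContinuousOn (fun s => B s (Z s)) (Icc 0 τ))
    (hwin : ∀ ε : ℝ, 0 < ε → ε < τ → ∀ t ∈ Icc 0 (τ - ε),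
      Z (ε + t) = T t (Z ε) - ∫ s in (0 : ℝ)..t, K (t - s) (B (ε + s) (Z (ε + s)))) :
    ∀ t ∈ Icc 0 τ, Z t = T t (Z 0) - ∫ s in (0 : ℝ)..t, K (t - s) (B s (Z s)) := by
  intro t ht
  rcases eq_or_lt_of_le ht.1 with h0 | ht0
  · -- `t = 0`
    subst h0
    rw [intervalIntegral.integral_same, sub_zero, hT0, one_apply_eq_self]
  -- `0 < t ≤ τ`: the integrand on `[0, t]` and its integrability
  set f : ℝ → E := fun s => K (t - s) (B s (Z s)) with hf
  obtain ⟨g, hgc, hge⟩ := exists_continuous_eqOn_Icc hg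
  have hI : IntervalIntegrable f volume 0 t :=
    (intervalIntegrable_duhamelIntegrand hK hKc hα hgc ht0.le).congr fun s hs => by
      rw [uIoc_of_le ht0.le] at hs
      simp only [hf, hge ⟨hs.1.le, hs.2.trans ht.2⟩]
  -- the window identity at `t`, rewritten on `[ε, t]`
  have hwin' : ∀ ε ∈ Ioo 0 t, Z t = T (t - ε) (Z ε) - ∫ s in ε..t, f s := by
    intro ε hε
    have hετ : ε < τ := hε.2.trans_le ht.2
    have h := hwin ε hε.1 hετ (t - ε) ⟨sub_nonneg.2 hε.2.le, sub_le_sub_right ht.2 ε⟩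
    rw [add_sub_cancel] at h
    rw [h]
    congr 1
    have hsub : (fun s => K (t - ε - s) (B (ε + s) (Z (ε + s)))) = fun s => f (ε + s) := by
      funext s
      simp only [hf, sub_add_eq_sub_sub]
    rw [hsub, intervalIntegral.integral_comp_add_left f ε, add_zero, add_sub_cancel]
  -- the right-hand side tends to `T t (Z 0) - ∫₀ᵗ f` as `ε → 0⁺`
  have hIcc : Icc 0 τ ∈ 𝓝[>] (0 : ℝ) := Icc_mem_nhdsGT (ht0.trans_le ht.2)
  have hZ0 : Tendsto Z (𝓝[>] 0) (𝓝 (Z 0)) :=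
    ((hZ 0 (left_mem_Icc.2 (ht.1.trans ht.2))).mono_of_mem_nhdsWithin hIcc).tendsto
  have h1 : Tendsto (fun ε => T (t - ε) (Z ε)) (𝓝[>] 0) (𝓝 (T t (Z 0))) := by
    rw [tendsto_iff_norm_sub_tendsto_zero]
    -- `‖T(t-ε) Z ε - T t Z 0‖ ≤ ‖Z ε - Z 0‖ + ‖T(t-ε) Z 0 - T t Z 0‖` for `0 < ε < t`
    have hb1 : Tendsto (fun ε => ‖Z ε - Z 0‖) (𝓝[>] 0) (𝓝 0) := tendsto_iff_norm_sub_tendsto_zero.1 hZ0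
    have hb2 : Tendsto (fun ε => ‖T (t - ε) (Z 0) - T t (Z 0)‖) (𝓝[>] 0) (𝓝 0) := by
      have hc : Tendsto (fun ε : ℝ => T (t - ε) (Z 0)) (𝓝 0) (𝓝 (T t (Z 0))) := by
        have h := ((hTc (Z 0)).comp (continuous_sub_left t)).tendsto 0
        simpa only [Function.comp_def, sub_zero] using h
      have h := (tendsto_iff_norm_sub_tendsto_zero.1 hc).mono_left (nhdsWithin_le_nhds (s := Ioi 0))
      exact h
    refine squeeze_zero' (Eventually.of_forall fun ε => norm_nonneg _) ?_ (by simpa using hb1.add hb2)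
    filter_upwards [Ioo_mem_nhdsGT ht0] with ε hε
    have hTε : ‖T (t - ε)‖ ≤ 1 := hTnorm _ (sub_nonneg.2 hε.2.le)
    calc ‖T (t - ε) (Z ε) - T t (Z 0)‖
        = ‖T (t - ε) (Z ε - Z 0) + (T (t - ε) (Z 0) - T t (Z 0))‖ := by
          rw [map_sub]; abel_nf
      _ ≤ ‖T (t - ε) (Z ε - Z 0)‖ + ‖T (t - ε) (Z 0) - T t (Z 0)‖ := norm_add_le _ _
      _ ≤ ‖Z ε - Z 0‖ + ‖T (t - ε) (Z 0) - T t (Z 0)‖ := by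
          gcongr
          calc ‖T (t - ε) (Z ε - Z 0)‖ ≤ ‖T (t - ε)‖ * ‖Z ε - Z 0‖ := (T (t - ε)).le_opNorm _
            _ ≤ 1 * ‖Z ε - Z 0‖ := by gcongr
            _ = ‖Z ε - Z 0‖ := one_mul _
  have h2 : Tendsto (fun ε => ∫ s in ε..t, f s) (𝓝[>] 0) (𝓝 (∫ s in (0 : ℝ)..t, f s)) := by
    have hc : ContinuousOn (fun ε => ∫ s in ε..t, f s) (uIcc 0 t) := by
      have h := intervalIntegral.continuousOn_primitive_interval' hI (right_mem_uIcc (a := 0) (b := t))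
      have heq : (fun ε => ∫ s in ε..t, f s) = fun ε => -∫ s in t..ε, f s := by
        funext ε
        rw [intervalIntegral.integral_symm]
      rw [heq]
      exact h.neg
    have h := (hc 0 left_mem_uIcc).tendsto
    rw [uIcc_of_le ht0.le] at h
    exact h.mono_left (nhdsWithin_le_of_mem (Icc_mem_nhdsGT ht0))
  have hlim : Tendsto (fun ε => T (t - ε) (Z ε) - ∫ s in ε..t, f s) (𝓝[>] 0)
      (𝓝 (T t (Z 0) - ∫ s in (0 : ℝ)..t, f s)) := h1.sub h2
  -- the left-hand side is constant
  have hconst : Tendsto (fun ε => T (t - ε) (Z ε) - ∫ s in ε..t, f s) (𝓝[>] 0) (𝓝 (Z t)) :=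
    tendsto_const_nhds.congr' (by
      filter_upwards [Ioo_mem_nhdsGT ht0] with ε hε
      exact hwin' ε hε)
  exact tendsto_nhds_unique hconst hlim

end Literature.Analysis.UnboundedOperators

end
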